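import Mathlib.RingTheory.RegularLocalRing.Defs
import Mathlib.RingTheory.Localization.LocalizationLocalization
import HarnessLib

/-!
# Localizations of regular rings are regular

Support file for crux stmt-ResolutionOfSingularities-15317 (`FrobeniusLadder.FRationalResolution`), line `redirect`,
lead c4 (toric surface programme: the stalks of the toric surface `Spec k[σ∨ ∩ ℤ²]` are direct summands of localizations
of the regular ring `k[ℕ²]`; to apply "regular domains have every ideal tightly closed" there, localizations of regular
rings must be regular — Mathlib's `IsRegularRing` (Noetherian, all local rings at primes regular) has no such lemma yet).

* `stub_isRegularRing_localization` — `IsRegularRing R → IsRegularRing (Localization M)` for every submonoid `M` of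
  `R`: `Localization M` is Noetherian (`IsLocalization.isNoetherianRing`), and its local ring at a prime `Q` is, as a
  ring, the local ring of `R` at the prime `Q ∩ R` (Mathlib
  `IsLocalization.localizationLocalizationAtPrimeIsoLocalization M Q : R_{Q ∩ R} ≃ₐ[R] (Localization M)_Q`), which is
  a regular local ring (`IsRegularRing.isRegularLocalRing_localization`); regularity of a local ring is transported
  along the ring isomorphism (`IsRegularLocalRing.of_ringEquiv`, instance found on the source).

The same five-line argument, universe-polymorphic, is `Literature.AlgebraicGeometry.Resolution.isRegularRing_localization`
(`Literature/AlgebraicGeometry/Resolution/FiniteQuotientSingularityPresentation.lean`); it is re-proved here from Mathlib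
alone so that this support file (and the `redirect` line through it) does not acquire that file's scheme-theoretic
imports. Folklore (Matsumura, *Commutative Ring Theory*, Thm. 19.3 and the remark after it: localizations of regular
rings at primes are regular, hence every localization of a regular ring is regular). [folklore]
-/

set_option linter.dupNamespace false

noncomputable section

namespace Summit.ResolutionOfSingularities.ResolutionOfSingularities.Theorems.FRationalResolution

/-- **Localizations of regular rings are regular.** If `R` is a regular ring (Mathlib `IsRegularRing`: Noetherian,
with `R_𝔭` a regular local ring for every prime `𝔭`), then so is `Localization M` for every submonoid `M ⊆ R`:
it is Noetherian, and for a prime `Q` of `Localization M` the local ring `(Localization M)_Q` is ring-isomorphic to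
`R_{Q ∩ R}` (`IsLocalization.localizationLocalizationAtPrimeIsoLocalization`), a regular local ring. [folklore] -/
theorem stub_isRegularRing_localization {R : Type} [CommRing R] [IsRegularRing R] (M : Submonoid R) :
    IsRegularRing (Localization M) := by
  haveI : IsNoetherianRing (Localization M) := IsLocalization.isNoetherianRing M _ inferInstance
  refine isRegularRing_iff.2 fun Q _ => ?_
  exact IsRegularLocalRing.of_ringEquiv
    (IsLocalization.localizationLocalizationAtPrimeIsoLocalization M Q).toRingEquiv

end Summit.ResolutionOfSingularities.ResolutionOfSingularities.Theorems.FRationalResolution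

end
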